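import Summits.SmoothPoincare4.SmoothPoincare4.Theorems.CongruenceShadowsNilpotentShadowsStandardJohnsonRealisers
import Literature.Topology.FourManifolds.SurfaceGroupCutKernels
import Summits.SmoothPoincare4.SmoothPoincare4.Theorems.CongruenceShadowsShadowApproximationStubLayerStepZeroPair
import HarnessLib

/-!
# Helper for stub `stub_layerStepOneZero` (line `nilpotent-genus-class`, crux
`CongruenceShadows.ShadowApproximation`, item stmt-SmoothPoincare4-14595):
# the seed realisers — Johnson's bounding-pair maps on any pair of adjacent handles

`S = SurfaceGroup (n + 3)`, letters `(j, false) = aⱼ`, `(j, true) = bⱼ`, `γₖ₊₁ = (⊤).lowerCentralSeries k`.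
For the layer step at `(m,c) = (1,0)` the SEEDS of the Goeritz–Johnson realisation are the genus-one
bounding-pair maps `bp_{k,k+1}` (Johnson 1980): `x_k ↦ c_k b_{k+1}⁻¹ x_k b_{k+1} c_k⁻¹`,
`a_{k+1} ↦ c_k b_{k+1}⁻¹ c_k⁻¹ b_{k+1} a_{k+1} c_k⁻¹`, `b_{k+1} ↦ c_k b_{k+1} c_k⁻¹` (`c_k = [a_k, b_k]`), which

* are IA and realise the letter triple `(b_k, a_k, b_{k+1})`:
  `ψ(x) x⁻¹ ≡ ⁅a_k, b_{k+1}⁆^⟨x,b_k⟩ ⁅b_{k+1}, b_k⁆^⟨x,a_k⟩ ⁅b_k, a_k⁆^⟨x,b_{k+1}⟩ (mod γ₃)`, `τ₁ = b_k ∧ a_k ∧ b_{k+1}`;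
* stabilise EVERY cut kernel `SurfaceGroup.cutKernel c` (one cut letter per handle), in particular the three standard
  kernels `N i = s4Kernels.stabilizeIter m i` — they lie in the Goeritz group `A ∩ B` (and in `C`).

`exists_bp_full` is the case `k = 0` (the landed `exists_bpAut`/`realise_bp`, re-proved for ONE automorphism together
with the erasure test of `SurfaceGroupCutKernels`); `exists_bp_handle` transports it to the handles `(k, k+1)` by
conjugating with the `k`-th power of the handle rotation (`exists_rotAut`), which permutes the cut kernels
(`map_cutKernel_rot`) and shifts Johnson values exactly.  No definitions.
-/

set_option linter.dupNamespace false

open Subgroup Literature.Topology.FourManifolds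
open Summit.SmoothPoincare4.SmoothPoincare4.Theorems.NilpotentShadowsStandard.SaturatedTorsorDescent
open scoped commutatorElement

namespace Summit.SmoothPoincare4.SmoothPoincare4.Theorems.ShadowApproximation.NilpotentGenusClass

/-! ## The bounding-pair map on handles `0, 1` -/

section BoundingPair

variable {n : ℕ}

/-- **The bounding-pair map of `S_{n+3}` on handles `0, 1` with everything the layer step needs**: it is IA,
realises the letter triple `(b₀, a₀, b₁)` (`τ₁ = b₀ ∧ a₀ ∧ b₁`), and STABILISES EVERY CUT KERNEL
`SurfaceGroup.cutKernel c` (erasure test on the images `c₀b₁⁻¹x₀b₁c₀⁻¹`, `c₀b₁⁻¹c₀⁻¹b₁a₁c₀⁻¹`, `c₀b₁c₀⁻¹` of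
the cut letters and on their inverse images).  The IA/realiser part is the landed `realise_bp`, repeated for the
SAME automorphism (adapted from `…NilpotentShadowsStandardJohnsonRealisers`). [cite: Johnson1980AbelianQuotient, Lemma 4B] -/
theorem exists_bp_full (n : ℕ) :
    ∃ ψ : SurfaceGroup (n + 3) ≃* SurfaceGroup (n + 3), (∀ s : SurfaceGroup (n + 3), ψ s * s⁻¹ ∈ (⊤ : Subgroup (SurfaceGroup (n + 3))).lowerCentralSeries 1) ∧ (∀ x : Fin (n + 3) × Bool, ψ (PresentedGroup.of x : SurfaceGroup (n + 3)) * (PresentedGroup.of x : SurfaceGroup (n + 3))⁻¹ * (⁅(PresentedGroup.of ((0 : Fin (n + 3)), false) : SurfaceGroup (n + 3)), (PresentedGroup.of ((1 : Fin (n + 3)), true) : SurfaceGroup (n + 3))⁆ ^ (if x.1 = ((0 : Fin (n + 3)), true).1 ∧ x.2 = false ∧ ((0 : Fin (n + 3)), true).2 = true then (1 : ℤ) else if x.1 = ((0 : Fin (n + 3)), true).1 ∧ x.2 = true ∧ ((0 : Fin (n + 3)), true).2 = false then (-1 : ℤ) else 0) * ⁅(PresentedGroup.of ((1 : Fin (n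 + 3)), true) : SurfaceGroup (n + 3)), (PresentedGroup.of ((0 : Fin (n + 3)), true) : SurfaceGroup (n + 3))⁆ ^ (if x.1 = ((0 : Fin (n + 3)), false).1 ∧ x.2 = false ∧ ((0 : Fin (n + 3)), false).2 = true then (1 : ℤ) else if x.1 = ((0 : Fin (n + 3)), false).1 ∧ x.2 = true ∧ ((0 : Fin (n + 3)), false).2 = false then (-1 : ℤ) else 0) * ⁅(PresentedGroup.of ((0 : Fin (n + 3)), true) : SurfaceGroup (n + 3)), (PresentedGroup.of ((0 : Fin (n + 3)), false) : SurfaceGroup (n + 3))⁆ ^ (if x.1 = ((1 : Fin (n + 3)), true).1 ∧ x.2 = false ∧ ((1 : Fin (n + 3)), true).2 = true then (1 : ℤ) else if x.1 = ((1 : Fin (n + 3)), true).1 ∧ x.2 = true ∧ ((1 : Fin (n + 3)), true).2 = false then (-1 : ℤ) else 0))⁻¹ ∈ (⊤ : Subgroup (SurfaceGroup (n + 3))).lowerCentralSeries 2) ∧ ∀ c : Fin (n + 3) → Bool, (SurfaceGroup.cutKernel c).map ψ.toMonoidHom = SurfaceGroup.cutKernel c := by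
  -- adapted from the landed `realise_bp` (…NilpotentShadowsStandardJohnsonRealisers), same automorphism
  have h10 := fin_one_ne_zero n
  have h01 : (0 : Fin (n + 3)) ≠ 1 := fun h => h10 h.symm
  obtain ⟨ψ, hψ, hψ'⟩ := exists_bpAut n
  have hof : ∀ x : Fin (n + 3) × Bool, ψ (PresentedGroup.of x) = PresentedGroup.mk _ (
      (fun x : Fin (n + 3) × Bool =>
      if x.1 = 0 then ⁅genA (0 : Fin (n + 3)), genB 0⁆ * (genB 1)⁻¹ * FreeGroup.of x * genB 1 * (⁅genA (0 : Fin (n + 3)), genB 0⁆)⁻¹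
      else if x = (1, false) then ⁅genA (0 : Fin (n + 3)), genB 0⁆ * (genB 1)⁻¹ * (⁅genA (0 : Fin (n + 3)), genB 0⁆)⁻¹ * genB 1 * genA 1 * (⁅genA (0 : Fin (n + 3)), genB 0⁆)⁻¹
      else if x = (1, true) then ⁅genA (0 : Fin (n + 3)), genB 0⁆ * genB 1 * (⁅genA (0 : Fin (n + 3)), genB 0⁆)⁻¹
      else FreeGroup.of x) x) := fun x => by
    rw [PresentedGroup.of, hψ, FreeGroup.lift_apply_of]
  -- values on the letters (exact identities in `S`)
  have ea0 : ψ (PresentedGroup.of (0, false) : SurfaceGroup (n + 3)) * (PresentedGroup.of (0, false) : SurfaceGroup (n + 3))⁻¹ =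
      ⁅⁅(PresentedGroup.of (0, false) : SurfaceGroup (n + 3)), (PresentedGroup.of (0, true) : SurfaceGroup (n + 3))⁆, (PresentedGroup.of (1, true) : SurfaceGroup (n + 3))⁻¹ * (PresentedGroup.of (0, false) : SurfaceGroup (n + 3)) * (PresentedGroup.of (1, true) : SurfaceGroup (n + 3))⁆ * ⁅(PresentedGroup.of (1, true) : SurfaceGroup (n + 3))⁻¹, (PresentedGroup.of (0, false) : SurfaceGroup (n + 3))⁆ := by
    rw [hof]; simp only [commutatorElement_def, map_mul, map_inv, genA, genB, if_true, if_false, Prod.mk.injEq, and_true, and_false, Bool.false_eq_true, PresentedGroup.of]; group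
  have eb0 : ψ (PresentedGroup.of (0, true) : SurfaceGroup (n + 3)) * (PresentedGroup.of (0, true) : SurfaceGroup (n + 3))⁻¹ =
      ⁅⁅(PresentedGroup.of (0, false) : SurfaceGroup (n + 3)), (PresentedGroup.of (0, true) : SurfaceGroup (n + 3))⁆, (PresentedGroup.of (1, true) : SurfaceGroup (n + 3))⁻¹ * (PresentedGroup.of (0, true) : SurfaceGroup (n + 3)) * (PresentedGroup.of (1, true) : SurfaceGroup (n + 3))⁆ * ⁅(PresentedGroup.of (1, true) : SurfaceGroup (n + 3))⁻¹, (PresentedGroup.of (0, true) : SurfaceGroup (n + 3))⁆ := by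
    rw [hof]; simp only [commutatorElement_def, map_mul, map_inv, genA, genB, if_true, if_false, Prod.mk.injEq, and_true, and_false, Bool.true_eq_false, PresentedGroup.of]; group
  have ea1 : ψ (PresentedGroup.of (1, false) : SurfaceGroup (n + 3)) * (PresentedGroup.of (1, false) : SurfaceGroup (n + 3))⁻¹ =
      ⁅⁅(PresentedGroup.of (0, false) : SurfaceGroup (n + 3)), (PresentedGroup.of (0, true) : SurfaceGroup (n + 3))⁆, (PresentedGroup.of (1, true) : SurfaceGroup (n + 3))⁻¹⁆ * ⁅(PresentedGroup.of (1, false) : SurfaceGroup (n + 3)), (⁅(PresentedGroup.of (0, false) : SurfaceGroup (n + 3)), (PresentedGroup.of (0, true) : SurfaceGroup (n + 3))⁆)⁻¹⁆ * (⁅(PresentedGroup.of (0, false) : SurfaceGroup (n + 3)), (PresentedGroup.of (0, true) : SurfaceGroup (n + 3))⁆)⁻¹ := by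
    rw [hof]; simp only [commutatorElement_def, map_mul, map_inv, genA, genB, if_true, if_false, h10, Prod.mk.injEq, and_false, Bool.false_eq_true, PresentedGroup.of]; group
  have eb1 : ψ (PresentedGroup.of (1, true) : SurfaceGroup (n + 3)) * (PresentedGroup.of (1, true) : SurfaceGroup (n + 3))⁻¹ = ⁅⁅(PresentedGroup.of (0, false) : SurfaceGroup (n + 3)), (PresentedGroup.of (0, true) : SurfaceGroup (n + 3))⁆, (PresentedGroup.of (1, true) : SurfaceGroup (n + 3))⁆ := by
    rw [hof]; simp only [commutatorElement_def, map_mul, map_inv, genA, genB, if_true, if_false, h10, Prod.mk.injEq, and_false, Bool.true_eq_false, PresentedGroup.of]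
  have ene : ∀ (j : Fin (n + 3)) (ε : Bool), j ≠ 0 → j ≠ 1 →
      ψ (PresentedGroup.of (j, ε)) * (PresentedGroup.of (j, ε) : SurfaceGroup (n + 3))⁻¹ = 1 := fun j ε hj0 hj1 => by
    rw [hof]; simp [hj0, hj1, PresentedGroup.of]
  -- IA: `ψ` induces the identity on the abelianisation
  have hIA : (∀ s : SurfaceGroup (n + 3), ψ s * s⁻¹ ∈ (⊤ : Subgroup (SurfaceGroup (n + 3))).lowerCentralSeries 1) := by
    have hhom : (Abelianization.of).comp ψ.toMonoidHom =
        (Abelianization.of : SurfaceGroup (n + 3) →* Abelianization (SurfaceGroup (n + 3))) := by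
      refine PresentedGroup.ext fun x => ?_
      rw [MonoidHom.comp_apply, MulEquiv.coe_toMonoidHom, hof]
      apply Additive.ofMul.injective
      obtain ⟨j, ε⟩ := x
      by_cases h0 : j = 0
      · subst h0
        cases ε <;> simp only [commutatorElement_def, map_mul, map_inv, genA, genB, if_true, if_false, Prod.mk.injEq, and_true, and_false, Bool.false_eq_true, Bool.true_eq_false, PresentedGroup.of, ofMul_mul, ofMul_inv] <;> abel
      by_cases h1 : j = 1
      · subst h1
        cases ε <;> simp only [commutatorElement_def, map_mul, map_inv, genA, genB, if_true, if_false, h10, Prod.mk.injEq, and_false, Bool.false_eq_true, Bool.true_eq_false, PresentedGroup.of, ofMul_mul, ofMul_inv] <;> abel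
      · simp [h0, h1, PresentedGroup.of]
    intro s
    have hs := DFunLike.congr_fun hhom s
    simp only [MonoidHom.comp_apply, MulEquiv.coe_toMonoidHom] at hs
    rw [Subgroup.top_lowerCentralSeries_one, ← Abelianization.ker_of, MonoidHom.mem_ker, map_mul,
      map_inv, hs, mul_inv_cancel]
  have hC : ∀ z : SurfaceGroup (n + 3) ⧸ (⊤ : Subgroup (SurfaceGroup (n + 3))).lowerCentralSeries 2, ⁅((⁅(PresentedGroup.of (0, false) : SurfaceGroup (n + 3)), (PresentedGroup.of (0, true) : SurfaceGroup (n + 3))⁆ : SurfaceGroup (n + 3)) : SurfaceGroup (n + 3) ⧸ (⊤ : Subgroup (SurfaceGroup (n + 3))).lowerCentralSeries 2), z⁆ = 1 := fun z => by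
    rw [quot_commutatorElement]; exact quot_class_two _ _ _
  -- `ψ` stabilises every cut kernel (erasure test on the images of the cut letters)
  have himg : ∀ (ε : Bool), ψ (PresentedGroup.of (0, ε) : SurfaceGroup (n + 3)) =
      ⁅(SurfaceGroup.a 0 : SurfaceGroup (n + 3)), SurfaceGroup.b 0⁆ * (SurfaceGroup.b 1)⁻¹ * PresentedGroup.of (0, ε) *
        SurfaceGroup.b 1 * (⁅(SurfaceGroup.a 0 : SurfaceGroup (n + 3)), SurfaceGroup.b 0⁆)⁻¹ := fun ε => by
    rw [hof]; simp only [commutatorElement_def, map_mul, map_inv, genA, genB, if_true,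
      PresentedGroup.of, SurfaceGroup.a, SurfaceGroup.b]
  have himg1a : ψ (PresentedGroup.of (1, false) : SurfaceGroup (n + 3)) =
      ⁅(SurfaceGroup.a 0 : SurfaceGroup (n + 3)), SurfaceGroup.b 0⁆ * (SurfaceGroup.b 1)⁻¹ *
        (⁅(SurfaceGroup.a 0 : SurfaceGroup (n + 3)), SurfaceGroup.b 0⁆)⁻¹ * SurfaceGroup.b 1 * SurfaceGroup.a 1 *
        (⁅(SurfaceGroup.a 0 : SurfaceGroup (n + 3)), SurfaceGroup.b 0⁆)⁻¹ := by
    rw [hof]; simp only [commutatorElement_def, map_mul, map_inv, genA, genB, if_true, if_false, h10,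
      Prod.mk.injEq, true_and, PresentedGroup.of, SurfaceGroup.a, SurfaceGroup.b]
  have himg1b : ψ (PresentedGroup.of (1, true) : SurfaceGroup (n + 3)) =
      ⁅(SurfaceGroup.a 0 : SurfaceGroup (n + 3)), SurfaceGroup.b 0⁆ * SurfaceGroup.b 1 *
        (⁅(SurfaceGroup.a 0 : SurfaceGroup (n + 3)), SurfaceGroup.b 0⁆)⁻¹ := by
    rw [hof]; simp only [commutatorElement_def, map_mul, map_inv, genA, genB, if_true, if_false, h10,
      Prod.mk.injEq, and_false, Bool.true_eq_false, PresentedGroup.of, SurfaceGroup.a,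
      SurfaceGroup.b]
  have himg_ne : ∀ (j : Fin (n + 3)) (ε : Bool), j ≠ 0 → j ≠ 1 →
      ψ (PresentedGroup.of (j, ε)) = (PresentedGroup.of (j, ε) : SurfaceGroup (n + 3)) := fun j ε hj0 hj1 => by
    rw [hof]; simp [hj0, hj1, PresentedGroup.of]
  have hof' : ∀ x : Fin (n + 3) × Bool, ψ.symm (PresentedGroup.of x) = PresentedGroup.mk _ (
      (fun x : Fin (n + 3) × Bool =>
      if x.1 = 0 then genB 1 * (⁅genA (0 : Fin (n + 3)), genB 0⁆)⁻¹ * FreeGroup.of x * ⁅genA (0 : Fin (n + 3)), genB 0⁆ * (genB 1)⁻¹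
      else if x = (1, false) then
        genB 1 * (⁅genA (0 : Fin (n + 3)), genB 0⁆)⁻¹ * (genB 1)⁻¹ * ⁅genA (0 : Fin (n + 3)), genB 0⁆ * genA 1 * genB 1 * ⁅genA (0 : Fin (n + 3)), genB 0⁆ * (genB 1)⁻¹
      else if x = (1, true) then genB 1 * (⁅genA (0 : Fin (n + 3)), genB 0⁆)⁻¹ * genB 1 * ⁅genA (0 : Fin (n + 3)), genB 0⁆ * (genB 1)⁻¹
      else FreeGroup.of x) x) := fun x => by
    rw [PresentedGroup.of, hψ', FreeGroup.lift_apply_of]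
  have himg' : ∀ (ε : Bool), ψ.symm (PresentedGroup.of (0, ε) : SurfaceGroup (n + 3)) =
      SurfaceGroup.b 1 * (⁅(SurfaceGroup.a 0 : SurfaceGroup (n + 3)), SurfaceGroup.b 0⁆)⁻¹ * PresentedGroup.of (0, ε) *
        ⁅(SurfaceGroup.a 0 : SurfaceGroup (n + 3)), SurfaceGroup.b 0⁆ * (SurfaceGroup.b 1)⁻¹ := fun ε => by
    rw [hof']; simp only [commutatorElement_def, map_mul, map_inv, genA, genB, if_true,
      PresentedGroup.of, SurfaceGroup.a, SurfaceGroup.b]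
  have himg1a' : ψ.symm (PresentedGroup.of (1, false) : SurfaceGroup (n + 3)) =
      SurfaceGroup.b 1 * (⁅(SurfaceGroup.a 0 : SurfaceGroup (n + 3)), SurfaceGroup.b 0⁆)⁻¹ * (SurfaceGroup.b 1)⁻¹ *
        ⁅(SurfaceGroup.a 0 : SurfaceGroup (n + 3)), SurfaceGroup.b 0⁆ * SurfaceGroup.a 1 * SurfaceGroup.b 1 *
        ⁅(SurfaceGroup.a 0 : SurfaceGroup (n + 3)), SurfaceGroup.b 0⁆ * (SurfaceGroup.b 1)⁻¹ := by
    rw [hof']; simp only [commutatorElement_def, map_mul, map_inv, genA, genB, if_true, if_false, h10,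
      Prod.mk.injEq, true_and, PresentedGroup.of, SurfaceGroup.a, SurfaceGroup.b]
  have himg1b' : ψ.symm (PresentedGroup.of (1, true) : SurfaceGroup (n + 3)) =
      SurfaceGroup.b 1 * (⁅(SurfaceGroup.a 0 : SurfaceGroup (n + 3)), SurfaceGroup.b 0⁆)⁻¹ * SurfaceGroup.b 1 *
        ⁅(SurfaceGroup.a 0 : SurfaceGroup (n + 3)), SurfaceGroup.b 0⁆ * (SurfaceGroup.b 1)⁻¹ := by
    rw [hof']; simp only [commutatorElement_def, map_mul, map_inv, genA, genB, if_true, if_false, h10,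
      Prod.mk.injEq, and_false, Bool.true_eq_false, PresentedGroup.of, SurfaceGroup.a,
      SurfaceGroup.b]
  have himg_ne' : ∀ (j : Fin (n + 3)) (ε : Bool), j ≠ 0 → j ≠ 1 →
      ψ.symm (PresentedGroup.of (j, ε)) = (PresentedGroup.of (j, ε) : SurfaceGroup (n + 3)) := fun j ε hj0 hj1 => by
    rw [hof']; simp [hj0, hj1, PresentedGroup.of]
  have hcut : ∀ c : Fin (n + 3) → Bool,
      (SurfaceGroup.cutKernel c).map ψ.toMonoidHom = SurfaceGroup.cutKernel c := by
    intro c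
    -- the erasure homomorphism of `c` and its values
    set E : SurfaceGroup (n + 3) →* FreeGroup (Fin (n + 3)) :=
      SurfaceGroup.eraseA.comp (SurfaceGroup.cutSwapEquiv c).symm.toMonoidHom with hE
    have hEapp : ∀ s, E s = SurfaceGroup.eraseA ((SurfaceGroup.cutSwapEquiv c).symm s) := fun s => rfl
    have hEcut : ∀ i, E (PresentedGroup.of (i, c i)) = 1 := fun i => by rw [hEapp, SurfaceGroup.erase_of_cut]
    have hEcomm : ∀ j, E ⁅(SurfaceGroup.a j : SurfaceGroup (n + 3)), SurfaceGroup.b j⁆ = 1 := fun j => by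
      rw [map_commutatorElement]
      cases hc : c j
      · rw [hEapp (SurfaceGroup.a j), SurfaceGroup.erase_a_of_eq_false c hc, commutatorElement_one_left]
      · rw [hEapp (SurfaceGroup.b j), SurfaceGroup.erase_b_of_eq_true c hc, commutatorElement_one_right]
    have hEcomm' : ∀ j, SurfaceGroup.eraseA ((SurfaceGroup.cutSwapEquiv c).symm
        ⁅(SurfaceGroup.a j : SurfaceGroup (n + 3)), SurfaceGroup.b j⁆) = 1 := fun j => hEcomm j
    have hEcut' : ∀ i, SurfaceGroup.eraseA ((SurfaceGroup.cutSwapEquiv c).symm (PresentedGroup.of (i, c i))) = 1 :=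
      fun i => SurfaceGroup.erase_of_cut c i
    refine SurfaceGroup.map_cutKernel_eq_of ψ c c (fun i => ?_) (fun i => ?_)
    · by_cases hi0 : i = 0
      · subst hi0
        rw [himg]
        simp only [map_mul, map_inv, hEcomm', hEcut']
        group
      by_cases hi1 : i = 1
      · subst hi1
        cases hc : c 1
        · rw [show (PresentedGroup.of ((1 : Fin (n + 3)), false) : SurfaceGroup (n + 3)) = PresentedGroup.of (1, false) from rfl,
            himg1a]
          simp only [map_mul, map_inv, hEcomm', SurfaceGroup.erase_a_of_eq_false c hc]
          group
        · rw [show (PresentedGroup.of ((1 : Fin (n + 3)), true) : SurfaceGroup (n + 3)) = PresentedGroup.of (1, true) from rfl,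
            himg1b]
          simp only [map_mul, map_inv, hEcomm', SurfaceGroup.erase_b_of_eq_true c hc]
          group
      · rw [himg_ne i _ hi0 hi1, hEcut']
    · by_cases hi0 : i = 0
      · subst hi0
        rw [himg']
        simp only [map_mul, map_inv, hEcomm', hEcut']
        group
      by_cases hi1 : i = 1
      · subst hi1
        cases hc : c 1
        · rw [show (PresentedGroup.of ((1 : Fin (n + 3)), false) : SurfaceGroup (n + 3)) = PresentedGroup.of (1, false) from rfl,
            himg1a']
          simp only [map_mul, map_inv, hEcomm', SurfaceGroup.erase_a_of_eq_false c hc]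
          group
        · rw [show (PresentedGroup.of ((1 : Fin (n + 3)), true) : SurfaceGroup (n + 3)) = PresentedGroup.of (1, true) from rfl,
            himg1b']
          simp only [map_mul, map_inv, hEcomm', SurfaceGroup.erase_b_of_eq_true c hc]
          group
      · rw [himg_ne' i _ hi0 hi1, hEcut']
  refine ⟨ψ, hIA, fun x => ?_, hcut⟩
  rw [mul_inv_mem_iff_quot, quot_triple]
  obtain ⟨j, ε⟩ := x
  by_cases hj0 : j = 0
  · subst hj0
    cases ε
    · rw [ea0, QuotientGroup.mk_mul, quot_commutatorElement, hC, one_mul, quot_commutatorElement,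
        QuotientGroup.mk_inv, c2_inv_left quot_class_two, commutatorElement_inv]
      simp only [h01, and_true, and_false, if_true, if_false, Bool.false_eq_true, Bool.true_eq_false, zpow_zero, zpow_one, mul_one]
    · rw [eb0, QuotientGroup.mk_mul, quot_commutatorElement, hC, one_mul, quot_commutatorElement,
        QuotientGroup.mk_inv, c2_inv_left quot_class_two]
      simp only [h01, and_true, and_false, if_true, if_false, Bool.false_eq_true, Bool.true_eq_false, zpow_zero, zpow_one, zpow_neg, mul_one, one_mul]
  by_cases hj1 : j = 1
  · subst hj1
    cases ε
    · rw [ea1, QuotientGroup.mk_mul, QuotientGroup.mk_mul, quot_commutatorElement, hC, one_mul,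
        quot_commutatorElement, QuotientGroup.mk_inv, c2_inv_right quot_class_two, commutatorElement_inv,
        hC, one_mul, quot_commutatorElement, commutatorElement_inv]
      simp only [h10, and_true, and_false, if_true, if_false, Bool.false_eq_true, Bool.true_eq_false, zpow_zero, zpow_one, mul_one, one_mul]
    · rw [eb1, quot_commutatorElement, hC]
      simp only [h10, and_true, and_false, if_false, Bool.false_eq_true, Bool.true_eq_false, zpow_zero, mul_one]
  · rw [ene j ε hj0 hj1, QuotientGroup.mk_one]
    simp only [hj0, hj1, and_true, and_false, false_and, if_false, Bool.false_eq_true, Bool.true_eq_false, zpow_zero, mul_one]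

end BoundingPair

/-! ## Rotations and cut kernels -/

section Rotation

variable {n : ℕ}

/-- **Powers of the handle rotation**: for every `k` an automorphism with `x_j ↦ x_{j+k}` on the letters
(and `x_j ↦ x_{j-k}` for its inverse). [folklore] -/
theorem exists_rotPow (n : ℕ) (k : Fin (n + 3)) : ∃ ρ : SurfaceGroup (n + 3) ≃* SurfaceGroup (n + 3),
    (∀ x : Fin (n + 3) × Bool, ρ (PresentedGroup.of x) = (PresentedGroup.of (x.1 + k, x.2) : SurfaceGroup (n + 3))) ∧
    ∀ x : Fin (n + 3) × Bool, ρ.symm (PresentedGroup.of x) = (PresentedGroup.of (x.1 - k, x.2) : SurfaceGroup (n + 3)) := by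
  have key : ∃ ρ : SurfaceGroup (n + 3) ≃* SurfaceGroup (n + 3),
      ∀ x : Fin (n + 3) × Bool, ρ (PresentedGroup.of x) = (PresentedGroup.of (x.1 + k, x.2) : SurfaceGroup (n + 3)) := by
    induction k using Fin.induction with
    | zero => exact ⟨MulEquiv.refl _, fun x => by simp⟩
    | succ i ih =>
      obtain ⟨ρ, hρ⟩ := ih
      obtain ⟨ρ₁, hρ₁⟩ := exists_rotAut n
      refine ⟨ρ.trans ρ₁, fun x => ?_⟩
      rw [MulEquiv.trans_apply, hρ, hρ₁, add_assoc, Fin.coeSucc_eq_succ]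
  obtain ⟨ρ, hρ⟩ := key
  refine ⟨ρ, hρ, fun x => ρ.injective ?_⟩
  rw [MulEquiv.apply_symm_apply, hρ, sub_add_cancel]

/-- **Rotations permute the cut kernels**: if `ρ(x_j) = x_{j+k}` then `ρ(cutKernel c) = cutKernel (j ↦ c (j - k))`.
[folklore] -/
theorem map_cutKernel_rot (ρ : SurfaceGroup (n + 3) ≃* SurfaceGroup (n + 3)) (k : Fin (n + 3))
    (hρ : ∀ x : Fin (n + 3) × Bool, ρ (PresentedGroup.of x) = (PresentedGroup.of (x.1 + k, x.2) : SurfaceGroup (n + 3)))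
    (hρ' : ∀ x : Fin (n + 3) × Bool, ρ.symm (PresentedGroup.of x) = (PresentedGroup.of (x.1 - k, x.2) : SurfaceGroup (n + 3)))
    (c : Fin (n + 3) → Bool) :
    (SurfaceGroup.cutKernel c).map ρ.toMonoidHom = SurfaceGroup.cutKernel (fun j => c (j - k)) := by
  refine SurfaceGroup.map_cutKernel_eq_of ρ c (fun j => c (j - k)) (fun i => ?_) (fun i => ?_)
  · rw [hρ]
    have e : (PresentedGroup.of (i + k, c i) : SurfaceGroup (n + 3)) = PresentedGroup.of (i + k, (fun j => c (j - k)) (i + k)) := by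
      simp only [add_sub_cancel_right]
    rw [e, SurfaceGroup.erase_of_cut]
  · rw [hρ']
    exact SurfaceGroup.erase_of_cut c (i - k)

end Rotation

/-! ## The bounding-pair map on handles `k, k+1` -/

section Shift

variable {n : ℕ}

/-- **The bounding-pair map on the handles `k, k+1`** (indices mod `n+3`): an IA-automorphism realising the letter
triple `(b_k, a_k, b_{k+1})` and stabilising every cut kernel — the conjugate of `exists_bp_full` by the `k`-th power of
the handle rotation. [folklore] -/
theorem exists_bp_handle (n : ℕ) (k : Fin (n + 3)) :
    ∃ β : SurfaceGroup (n + 3) ≃* SurfaceGroup (n + 3), (∀ s : SurfaceGroup (n + 3), β s * s⁻¹ ∈ (⊤ : Subgroup (SurfaceGroup (n + 3))).lowerCentralSeries 1) ∧ (∀ x : Fin (n + 3) × Bool, β (PresentedGroup.of x : SurfaceGroup (n + 3)) * (PresentedGroup.of x : SurfaceGroup (n + 3))⁻¹ * (⁅(PresentedGroup.of (k, false) : SurfaceGroup (n + 3)), (PresentedGroup.of (k + 1, true) : SurfaceGroup (n + 3))⁆ ^ (if x.1 = (k, true).1 ∧ x.2 = false ∧ (k, true).2 = true then (1 : ℤ)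 else if x.1 = (k, true).1 ∧ x.2 = true ∧ (k, true).2 = false then (-1 : ℤ) else 0) * ⁅(PresentedGroup.of (k + 1, true) : SurfaceGroup (n + 3)), (PresentedGroup.of (k, true) : SurfaceGroup (n + 3))⁆ ^ (if x.1 = (k, false).1 ∧ x.2 = false ∧ (k, false).2 = true then (1 : ℤ) else if x.1 = (k, false).1 ∧ x.2 = true ∧ (k, false).2 = false then (-1 : ℤ) else 0) * ⁅(PresentedGroup.of (k, true) : SurfaceGroup (n + 3)), (PresentedGroup.of (k, false) : SurfaceGroup (n + 3))⁆ ^ (if x.1 = (k + 1, true).1 ∧ x.2 = false ∧ (k + 1, true).2 = true then (1 : ℤ) else if x.1 = (k + 1, true).1 ∧ x.2 = true ∧ (k + 1, true).2 = false then (-1 : ℤ) else 0))⁻¹ ∈ (⊤ : Subgroup (SurfaceGroup (n + 3))).lowerCentralSeries 2) ∧ ∀ c : Fin (n + 3) → Bool, (SurfaceGroup.cutKernel c).map β.toMonoidHom = SurfaceGroup.cutKernel c := by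
  obtain ⟨ψ, hψIA, hψτ, hψcut⟩ := exists_bp_full n
  obtain ⟨ρ, hρ, hρ'⟩ := exists_rotPow n k
  refine ⟨ρ.symm.trans (ψ.trans ρ), ia_conj hψIA ρ, fun x => ?_, fun c => ?_⟩
  · -- the Johnson value at `x` is `ρ` applied to the value of `ψ` at `x' = (x.1 - k, x.2)`, exactly
    have hk0 : ∀ y : Fin (n + 3), (y - k = 0) ↔ (y = k) := fun y => sub_eq_zero
    have hk1 : ∀ y : Fin (n + 3), (y - k = 1) ↔ (y = k + 1) := fun y => by rw [sub_eq_iff_eq_add, add_comm (1 : Fin (n + 3)) k]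
    rw [mul_inv_mem_iff_quot, conj_tau, hρ']
    have h := (mul_inv_mem_iff_quot _ _ _).1 (hψτ (x.1 - k, x.2))
    rw [quot_congr_equiv ρ h]
    simp only [map_mul, map_zpow, map_commutatorElement, hρ, zero_add, add_comm (1 : Fin (n + 3)) k, hk0, hk1]
  · rw [map_trans, map_trans]
    have h1 : (SurfaceGroup.cutKernel c).map ρ.symm.toMonoidHom = SurfaceGroup.cutKernel (fun j => c (j + k)) := by
      have := map_cutKernel_rot ρ.symm (-k) (fun x => by rw [hρ', sub_eq_add_neg]) (fun x => by
        rw [MulEquiv.symm_symm, hρ, sub_neg_eq_add]) c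
      simpa only [sub_neg_eq_add] using this
    rw [h1, hψcut, map_cutKernel_rot ρ k hρ hρ']
    congr 1
    funext j
    simp only [sub_add_cancel]

end Shift

/-! ## Registered helper -/

/-- **Registered helper `helper_bpHandle`** (sub-goal of stub `stub_layerStepOneZero`, crux stmt-SmoothPoincare4-14595):
the bounding-pair map on the handles `k, k+1` of `S_{n+3}` — IA, realising `(b_k, a_k, b_{k+1})`, stabilising every cut
kernel — in closed form (commutators spelled out). [folklore] -/
theorem helper_bpHandle : ∀ (n : ℕ) (k : Fin (n + 3)), ∃ β : SurfaceGroup (n + 3) ≃* SurfaceGroup (n + 3), (∀ s : SurfaceGroup (n + 3), β s * s⁻¹ ∈ (⊤ : Subgroup (SurfaceGroup (n + 3))).lowerCentralSeries 1) ∧ (∀ x : Fin (n + 3) × Bool, β (PresentedGroup.of x : SurfaceGroup (n + 3)) * (PresentedGroup.of x : SurfaceGroup (n + 3))⁻¹ * (((PresentedGroup.of (k, false) : SurfaceGroup (n + 3)) * (PresentedGroup.of (k + 1, true) : SurfaceGroup (n + 3)) * (PresentedGroup.of (k, false) : SurfaceGroup (n + 3))⁻¹ * (PresentedGroup.of (k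 + 1, true) : SurfaceGroup (n + 3))⁻¹) ^ (if x.1 = (k, true).1 ∧ x.2 = false ∧ (k, true).2 = true then (1 : ℤ) else if x.1 = (k, true).1 ∧ x.2 = true ∧ (k, true).2 = false then (-1 : ℤ) else 0) * ((PresentedGroup.of (k + 1, true) : SurfaceGroup (n + 3)) * (PresentedGroup.of (k, true) : SurfaceGroup (n + 3)) * (PresentedGroup.of (k + 1, true) : SurfaceGroup (n + 3))⁻¹ * (PresentedGroup.of (k, true) : SurfaceGroup (n + 3))⁻¹) ^ (if x.1 = (k, false).1 ∧ x.2 = false ∧ (k, false).2 = true then (1 : ℤ) else if x.1 = (k, false).1 ∧ x.2 = true ∧ (k, false).2 = false then (-1 : ℤ) else 0) * ((PresentedGroup.of (k, true) : SurfaceGroup (n + 3)) * (PresentedGroup.of (k, false) : SurfaceGroup (n + 3)) * (PresentedGroup.of (k, true) : SurfaceGroup (n + 3))⁻¹ * (PresentedGroup.of (k, false) : SurfaceGroup (n + 3))⁻¹) ^ (if x.1 = (k + 1, true).1 ∧ x.2 = false ∧ (k + 1, true).2 = true then (1 : ℤ) else if x.1 = (k + 1, true).1 ∧ x.2 = true ∧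 (k + 1, true).2 = false then (-1 : ℤ) else 0))⁻¹ ∈ (⊤ : Subgroup (SurfaceGroup (n + 3))).lowerCentralSeries 2) ∧ ∀ c : Fin (n + 3) → Bool, (SurfaceGroup.cutKernel c).map β.toMonoidHom = SurfaceGroup.cutKernel c :=
  fun n k => exists_bp_handle n k

end Summit.SmoothPoincare4.SmoothPoincare4.Theorems.ShadowApproximation.NilpotentGenusClass
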